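import Summits.HodgeConjecture.CorCM.Census.CyclicCharacterArcDistances
import Summits.HodgeConjecture.CorCM.Census.CyclicCharacterQuarticLaw

/-!
# Cyclic characters, XXII: SPECTATOR EQUATOR FACES — the unit arc shifts at the interior positions

COR-CM (cell `pub-hodgecm2`), count-neutral kernel combinatorics by the binder seat b09 (gen 42; lane CYCLIC-CHARACTER FIBRE LAW, part XXII), on parts XIX–XXI BY
NAME.  Theorems only (no definition, no `decide`, no certificate, no named fact, no `sorry`).
HONEST FRAMING: `HC_CM` is NOT proved, here or anywhere in the tree; nothing here is a period or a headline.

A SPECTATOR is a point `u ∈ T_0 ∩ T_1` (`w u ∉ {0}`, i.e. an interior or top point of `T_0`) flipped throughout the bottom walk.  For a type `X` with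
`T_0 ∖ X = D_0 ∪ {u}`, `D_0 ⊆ F_0`: `T_1 ∖ X = c·(F_0 ∖ D_0) ∪ {u}` (§1), so the normal forms of the spectator corners are those of part XVIII plus the flip
defect of `u`, and the three-across equator face carried by the spectator yields, through the toward property of ANY cover (parts XX/XXI: the corners have
deviation `(|F_0| ± 1)/2` with two `w`-values), the relation `R(B') + ([T_0^{(u)}] − [T_0]) − ([T_1^{(u)}] − [T_1])` (§2, `rel_of_threeAcross_spectator`).  With
`R(B')` from the plain face this is the UNIT ARC SHIFT at `u` (§3), and unit shifts telescope along `T_0 → T_1 → ⋯ → T_i` to the arc-shift vector `Y(u)`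
of part XVI (`shift_mem_of_unitShifts`).
-/

namespace Summit.HodgeConjecture.CorCM.Census.CyclicCharacter

open Finset
open Summit.HodgeConjecture.CorCM.Prior.AllgGroup.RfwfAllgGroup
open Summit.HodgeConjecture.CorCM.Census.BlockParity
open Summit.HodgeConjecture.CorCM.Census.Coinvariant
open Summit.HodgeConjecture.CorCM.Census.TwistGeneration
open Summit.HodgeConjecture.CorCM.Census.Nondegenerate
open Summit.HodgeConjecture.CorCM.Census.BaseBlock

noncomputable section

variable {G : Type*} [Group G] [Fintype G] [DecidableEq G] {k : ℕ} {w : G → ZMod (2 ^ k)} {c : G}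

/-! ## §1 Types deviating at bottom points and one spectator -/

/-- **The `T_1`-deviation with a spectator**: if `T_0 ∖ X = D_0 ∪ {u}` with `D_0 ⊆ F_0` and `u ∈ T_1`, then `T_1 ∖ X = c·(F_0 ∖ D_0) ∪ {u}`. [folklore] -/
theorem sdiff_arcType_one_eq_of_spectator (hw : ∀ P Q : G, w (P * Q) = w P + w Q) (hk : 1 ≤ k) (hc2 : c * c = 1) (hwc : w c ≠ 0) (X : CMF G c)
    {D₀ : Finset G} {u : G} (hX : (arcType hw hk hc2 hwc 0).1 \ X.1 = insert u D₀) (hD₀ : D₀ ⊆ univ.filter fun s => w s = 0)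
    (hu1 : u ∈ (arcType hw hk hc2 hwc 1).1) (hu0 : w u ≠ 0) :
    (arcType hw hk hc2 hwc 1).1 \ X.1 = insert u (((univ.filter fun s => w s = 0) \ D₀).image fun s => c * s) := by
  have huT : u ∈ (arcType hw hk hc2 hwc 0).1 ∧ u ∉ X.1 := by
    have : u ∈ (arcType hw hk hc2 hwc 0).1 \ X.1 := by rw [hX]; exact mem_insert_self u D₀
    exact mem_sdiff.mp this
  ext x
  rw [mem_insert, mem_image, mem_sdiff]
  constructor
  · rintro ⟨hxT1, hxX⟩
    by_cases hxT0 : x ∈ (arcType hw hk hc2 hwc 0).1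
    · -- a deviation point inside `T_1`: it is `u`
      have hdev : x ∈ (arcType hw hk hc2 hwc 0).1 \ X.1 := mem_sdiff.mpr ⟨hxT0, hxX⟩
      rw [hX, mem_insert] at hdev
      rcases hdev with rfl | hxD
      · exact Or.inl rfl
      · exfalso
        exact (mem_arcType_zero_and_notMem_one hw hk hc2 hwc (mem_filter.mp (hD₀ hxD)).2).2 hxT1
    · right
      have hcx : w (c * x) = 0 := (mem_arcType_one_sdiff_zero_iff hw hk hc2 hwc x).mp (mem_sdiff.mpr ⟨hxT1, hxT0⟩)
      have hcxT0 : c * x ∈ (arcType hw hk hc2 hwc 0).1 := (mem_arcType_zero_and_notMem_one hw hk hc2 hwc hcx).1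
      have hcxX : c * x ∈ X.1 := by by_contra h; exact hxX ((X.2 x).mpr h)
      refine ⟨c * x, mem_sdiff.mpr ⟨mem_filter.mpr ⟨mem_univ _, hcx⟩, fun h => ?_⟩, by rw [← mul_assoc, hc2, one_mul]⟩
      have : c * x ∈ (arcType hw hk hc2 hwc 0).1 \ X.1 := by rw [hX]; exact mem_insert_of_mem h
      exact (mem_sdiff.mp this).2 hcxX
  · rintro (rfl | ⟨s, hs, rfl⟩)
    · exact ⟨hu1, huT.2⟩
    · have hs0 : w s = 0 := (mem_filter.mp (mem_sdiff.mp hs).1).2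
      have hsT0 : s ∈ (arcType hw hk hc2 hwc 0).1 := (mem_arcType_zero_and_notMem_one hw hk hc2 hwc hs0).1
      have hsX : s ∈ X.1 := by
        by_contra h
        have : s ∈ (arcType hw hk hc2 hwc 0).1 \ X.1 := mem_sdiff.mpr ⟨hsT0, h⟩
        rw [hX, mem_insert] at this
        rcases this with rfl | h'
        · exact hu0 hs0
        · exact (mem_sdiff.mp hs).2 h'
      refine ⟨?_, (X.2 s).mp hsX⟩
      have h := (mem_arcType_one_sdiff_zero_iff hw hk hc2 hwc (c * s)).mpr (by rw [← mul_assoc, hc2, one_mul]; exact hs0)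
      exact (mem_sdiff.mp h).1

/-- **Distance to `T_1` with a spectator**: `ddist T_1 X + |D_0| = |F_0| + 1`. [folklore] -/
theorem ddist_arcType_one_of_spectator (hw : ∀ P Q : G, w (P * Q) = w P + w Q) (hk : 1 ≤ k) (hc2 : c * c = 1) (hwc : w c ≠ 0) (X : CMF G c)
    {D₀ : Finset G} {u : G} (hX : (arcType hw hk hc2 hwc 0).1 \ X.1 = insert u D₀) (hD₀ : D₀ ⊆ univ.filter fun s => w s = 0)
    (hu1 : u ∈ (arcType hw hk hc2 hwc 1).1) (hu0 : w u ≠ 0) :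
    ddist (arcType hw hk hc2 hwc 1) X + D₀.card = (univ.filter fun s : G => w s = 0).card + 1 := by
  unfold ddist
  rw [sdiff_arcType_one_eq_of_spectator hw hk hc2 hwc X hX hD₀ hu1 hu0, card_insert_of_notMem, card_image_of_injective _ (mul_right_injective c),
    add_right_comm, card_sdiff_add_card_eq_card hD₀]
  rw [mem_image]
  rintro ⟨s, hs, hsu⟩
  apply hwc
  have hs0 : w s = 0 := (mem_filter.mp (mem_sdiff.mp hs).1).2
  -- `u = c s` would put `u` outside `T_0`
  have huT0 : u ∈ (arcType hw hk hc2 hwc 0).1 := by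
    have : u ∈ (arcType hw hk hc2 hwc 0).1 \ X.1 := by rw [hX]; exact mem_insert_self u D₀
    exact (mem_sdiff.mp this).1
  exfalso
  rw [← hsu] at huT0
  exact ((arcType hw hk hc2 hwc 0).2 s).mp (mem_arcType_zero_and_notMem_one hw hk hc2 hwc hs0).1 huT0

/-- **The `T_1`-normal form with a spectator.** [folklore] -/
theorem normalForm_one_eq_of_spectator (hw : ∀ P Q : G, w (P * Q) = w P + w Q) (hk : 1 ≤ k) (hc2 : c * c = 1) (hwc : w c ≠ 0) (X : CMF G c)
    {D₀ : Finset G} {u : G} (hX : (arcType hw hk hc2 hwc 0).1 \ X.1 = insert u D₀) (hD₀ : D₀ ⊆ univ.filter fun s => w s = 0)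
    (hu1 : u ∈ (arcType hw hk hc2 hwc 1).1) (hu0 : w u ≠ 0) :
    (∑ x ∈ (arcType hw hk hc2 hwc 1).1 \ X.1,
        (Finsupp.single (oflipCM c hc2 x (arcType hw hk hc2 hwc 1)) (1 : ℤ) - Finsupp.single (arcType hw hk hc2 hwc 1) 1)) =
      (Finsupp.single (oflipCM c hc2 u (arcType hw hk hc2 hwc 1)) (1 : ℤ) - Finsupp.single (arcType hw hk hc2 hwc 1) 1) +
      ∑ t ∈ (univ.filter fun s => w s = 0) \ D₀,
        (Finsupp.single (oflipCM c hc2 t (arcType hw hk hc2 hwc 1)) (1 : ℤ) - Finsupp.single (arcType hw hk hc2 hwc 1) 1) := by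
  rw [sdiff_arcType_one_eq_of_spectator hw hk hc2 hwc X hX hD₀ hu1 hu0, sum_insert, sum_image fun x _ y _ h => mul_left_cancel h]
  · congr 1
    exact sum_congr rfl fun t _ => by rw [oflipCM_cmul]
  · rw [mem_image]
    rintro ⟨s, hs, hsu⟩
    have hs0 : w s = 0 := (mem_filter.mp (mem_sdiff.mp hs).1).2
    have huT0 : u ∈ (arcType hw hk hc2 hwc 0).1 := by
      have : u ∈ (arcType hw hk hc2 hwc 0).1 \ X.1 := by rw [hX]; exact mem_insert_self u D₀
      exact (mem_sdiff.mp this).1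
    rw [← hsu] at huT0
    exact ((arcType hw hk hc2 hwc 0).2 s).mp (mem_arcType_zero_and_notMem_one hw hk hc2 hwc hs0).1 huT0

/-! ## §2 The spectator three-across relation -/

/-- Uniqueness at a `T_0`-side corner: `T_0`-deviation of size `≤ (|F_0| + 1)/2` containing two `w`-values when large. [folklore] -/
theorem unique_base_zero (hw : ∀ P Q : G, w (P * Q) = w P + w Q) (hk : 1 ≤ k) (hc2 : c * c = 1) (hwc : w c ≠ 0) {Φ : CMF G c}
    (hD1 : 2 * (((arcType hw hk hc2 hwc 0)).1 \ Φ.1).card ≤ ((univ.filter fun s : G => w s = 0)).card + 1)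
    (hD2 : ((univ.filter fun s : G => w s = 0)).card ≤ 2 * (((arcType hw hk hc2 hwc 0)).1 \ Φ.1).card → ∃ d₁ ∈ ((arcType hw hk hc2 hwc 0)).1 \ Φ.1, ∃ d₂ ∈ ((arcType hw hk hc2 hwc 0)).1 \ Φ.1, w d₁ ≠ w d₂)
    (hn : 2 ≤ ((univ.filter fun s : G => w s = 0)).card) :
    ∀ Ψ : CMF G c, (rt c 1 (arcType hw hk hc2 hwc 0)).1 \ Ψ.1 ⊆ (rt c 1 (arcType hw hk hc2 hwc 0)).1 \ Φ.1 →
      ∀ Q : G, bpot c (arcType hw hk hc2 hwc 0) Ψ = ddist (rt c Q (arcType hw hk hc2 hwc 0)) Ψ → rt c Q (arcType hw hk hc2 hwc 0) = rt c 1 (arcType hw hk hc2 hwc 0) := by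
  have h := unique_of_sdiff_small hw hk hc2 hwc (Q₀ := 1) (Φ := Φ) (by rw [rt_one]; exact hD1) (by rw [rt_one]; exact hD2) hn
  exact h

/-- **THE SPECTATOR THREE-ACROSS RELATION.**  `T_0 ∖ X = B' ∪ {u}` with `B' ⊆ F_0`, `2|B'| + 1 = |F_0|`, `B'` non-empty, `u ∈ T_0 ∩ T_1` with `w u ≠ 0`;
`t ≠ t' ∈ F_0 ∖ B'`; `L` with the toward property containing `gface X t t'`.  Then
`R(B') + ([T_0^{(u)}] − [T_0]) − ([T_1^{(u)}] − [T_1]) ∈ L`. [folklore] -/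
theorem rel_of_threeAcross_spectator (hw : ∀ P Q : G, w (P * Q) = w P + w Q) (hk : 1 ≤ k) (hc2 : c * c = 1) (hwc : w c ≠ 0)
    (h1 : ∃ g₁ : G, w g₁ = 1) (L : Submodule ℤ (CMF G c →₀ ℤ))
    (htw : ∀ Φ : CMF G c, 2 ≤ bpot c (arcType hw hk hc2 hwc 0) Φ → ∃ Q t t' : G,
      bpot c (arcType hw hk hc2 hwc 0) Φ = ddist (rt c Q (arcType hw hk hc2 hwc 0)) Φ ∧
        t ∈ (rt c Q (arcType hw hk hc2 hwc 0)).1 \ Φ.1 ∧ t' ∈ (rt c Q (arcType hw hk hc2 hwc 0)).1 \ Φ.1 ∧ t ≠ t' ∧ gface c hc2 Φ t t' ∈ L)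
    {X : CMF G c} {B' : Finset G} {u : G} (hX : ((arcType hw hk hc2 hwc 0)).1 \ X.1 = insert u B') (hB' : B' ⊆ (univ.filter fun s : G => w s = 0)) (hB'ne : B'.Nonempty)
    (hm : 2 * B'.card + 1 = ((univ.filter fun s : G => w s = 0)).card) (hu0 : w u ≠ 0) (huT0 : u ∈ ((arcType hw hk hc2 hwc 0)).1) (huT1 : u ∈ ((arcType hw hk hc2 hwc 1)).1)
    {t t' : G} (ht : w t = 0) (ht' : w t' = 0) (htB : t ∉ B') (ht'B : t' ∉ B') (htt' : t ≠ t') (hf : gface c hc2 X t t' ∈ L) :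
    Finsupp.single (arcType hw hk hc2 hwc 0) (1 : ℤ) - Finsupp.single (arcType hw hk hc2 hwc 1) 1 +
      (∑ s ∈ B', (Finsupp.single (oflipCM c hc2 s (arcType hw hk hc2 hwc 0)) (1 : ℤ) - Finsupp.single (arcType hw hk hc2 hwc 0) 1)) - (∑ s ∈ (univ.filter fun s : G => w s = 0) \ B', (Finsupp.single (oflipCM c hc2 s (arcType hw hk hc2 hwc 1)) (1 : ℤ) - Finsupp.single (arcType hw hk hc2 hwc 1) 1)) +
      ((Finsupp.single (oflipCM c hc2 u (arcType hw hk hc2 hwc 0)) (1 : ℤ) - Finsupp.single (arcType hw hk hc2 hwc 0) 1) - (Finsupp.single (oflipCM c hc2 u (arcType hw hk hc2 hwc 1)) (1 : ℤ) - Finsupp.single (arcType hw hk hc2 hwc 1) 1)) ∈ L := by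
  obtain ⟨Qm, hQm⟩ := exists_apply_eq hw h1 (-1)
  have eT₁ : (arcType hw hk hc2 hwc 1) = rt c Qm (arcType hw hk hc2 hwc 0) := arcType_eq_rt hw hk hc2 hwc hQm
  have htF : t ∈ (univ.filter fun s : G => w s = 0) := mem_filter.mpr ⟨mem_univ _, ht⟩
  have ht'F : t' ∈ (univ.filter fun s : G => w s = 0) := mem_filter.mpr ⟨mem_univ _, ht'⟩
  have htu : t ≠ u := fun h => hu0 (h ▸ ht)
  have ht'u : t' ≠ u := fun h => hu0 (h ▸ ht')
  have huB : u ∉ B' := fun h => hu0 (mem_filter.mp (hB' h)).2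
  have hwcs : ∀ s : G, w s = 0 → w (c * s) ≠ w u := by
    intro s hs h
    rw [hw, hs, add_zero, apply_c hw hk hc2 hwc] at h
    have := (mem_arcType hw hk hc2 hwc 0 u).mp huT0
    rw [sub_zero, ← h, val_two_pow_pred hk] at this
    exact lt_irrefl _ this
  -- deviation sets of the four corners (from `T_0`)
  have hXt : ((arcType hw hk hc2 hwc 0)).1 \ (oflipCM c hc2 t X).1 = insert u (insert t B') := by
    rw [sdiff_oflipCM_eq_insert hw hk hc2 hwc hX ht (by rw [mem_insert]; push Not; exact ⟨htu, htB⟩), Finset.insert_comm]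
  have hXt' : ((arcType hw hk hc2 hwc 0)).1 \ (oflipCM c hc2 t' X).1 = insert u (insert t' B') := by
    rw [sdiff_oflipCM_eq_insert hw hk hc2 hwc hX ht' (by rw [mem_insert]; push Not; exact ⟨ht'u, ht'B⟩), Finset.insert_comm]
  have hXtt' : ((arcType hw hk hc2 hwc 0)).1 \ (oflipCM c hc2 t (oflipCM c hc2 t' X)).1 = insert u (insert t (insert t' B')) := by
    rw [sdiff_oflipCM_eq_insert hw hk hc2 hwc hXt' ht (by rw [mem_insert, mem_insert]; push Not; exact ⟨htu, htt', htB⟩), Finset.insert_comm]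
  have hBt : insert t B' ⊆ (univ.filter fun s : G => w s = 0) := insert_subset htF hB'
  have hBt' : insert t' B' ⊆ (univ.filter fun s : G => w s = 0) := insert_subset ht'F hB'
  have hBtt' : insert t (insert t' B') ⊆ (univ.filter fun s : G => w s = 0) := insert_subset htF hBt'
  have hct : (insert t B').card = B'.card + 1 := card_insert_of_notMem htB
  have hct' : (insert t' B').card = B'.card + 1 := card_insert_of_notMem ht'B
  have hctt' : (insert t (insert t' B')).card = B'.card + 2 := by
    rw [card_insert_of_notMem (by rw [mem_insert]; push Not; exact ⟨htt', htB⟩), hct']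
  have hcX : (insert u B').card = B'.card + 1 := card_insert_of_notMem huB
  -- `T_1`-deviations of the three `T_1`-side corners
  have hdevT1 := fun (Y : CMF G c) (D : Finset G) (hY : ((arcType hw hk hc2 hwc 0)).1 \ Y.1 = insert u D) (hD : D ⊆ (univ.filter fun s : G => w s = 0)) =>
    sdiff_arcType_one_eq_of_spectator hw hk hc2 hwc Y hY hD huT1 hu0
  -- uniqueness at the four corners
  obtain ⟨b, hb⟩ := hB'ne
  have hb0 : w b = 0 := (mem_filter.mp (hB' hb)).2
  have hB'c : 1 ≤ B'.card := card_pos.mpr ⟨b, hb⟩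
  have hn2 : 2 ≤ ((univ.filter fun s : G => w s = 0)).card := by omega
  have hU1 := unique_base_zero hw hk hc2 hwc (Φ := X) (by rw [hX, hcX]; omega)
    (fun _ => ⟨u, by rw [hX]; exact mem_insert_self _ _, b, by rw [hX]; exact mem_insert_of_mem hb, fun h => hu0 (h.trans hb0)⟩) hn2
  have hUT1 : ∀ (Y : CMF G c) (D : Finset G), ((arcType hw hk hc2 hwc 0)).1 \ Y.1 = insert u D → D ⊆ (univ.filter fun s : G => w s = 0) → ((univ.filter fun s : G => w s = 0)).card + 1 ≤ 2 * D.card →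
      ∀ Ψ : CMF G c, (rt c Qm (arcType hw hk hc2 hwc 0)).1 \ Ψ.1 ⊆ (rt c Qm (arcType hw hk hc2 hwc 0)).1 \ Y.1 →
        ∀ Q : G, bpot c (arcType hw hk hc2 hwc 0) Ψ = ddist (rt c Q (arcType hw hk hc2 hwc 0)) Ψ → rt c Q (arcType hw hk hc2 hwc 0) = rt c Qm (arcType hw hk hc2 hwc 0) := by
    intro Y D hY hD hDc
    have hdev := hdevT1 Y D hY hD
    have hcard : ((rt c Qm (arcType hw hk hc2 hwc 0)).1 \ Y.1).card + D.card = ((univ.filter fun s : G => w s = 0)).card + 1 := by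
      rw [← eT₁]; exact ddist_arcType_one_of_spectator hw hk hc2 hwc Y hY hD huT1 hu0
    refine unique_of_sdiff_small hw hk hc2 hwc (by omega) (fun hle => ?_) hn2
    -- two `w`-values in the `T_1`-deviation: `u` and a top point `c s`
    have hDlt : D.card < ((univ.filter fun s : G => w s = 0)).card := by omega
    have hne : (((univ.filter fun s : G => w s = 0)) \ D).Nonempty := by
      rw [nonempty_iff_ne_empty]; intro h
      have := card_sdiff_add_card_eq_card hD; rw [h, card_empty, zero_add] at this; omega
    obtain ⟨s, hs⟩ := hne
    refine ⟨u, ?_, c * s, ?_, fun h => hwcs s (mem_filter.mp (mem_sdiff.mp hs).1).2 h.symm⟩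
    · rw [← eT₁, hdev]; exact mem_insert_self _ _
    · rw [← eT₁, hdev]; exact mem_insert_of_mem (mem_image_of_mem _ hs)
  have hU2 := hUT1 _ _ hXtt' hBtt' (by rw [hctt']; omega)
  have hU3 := hUT1 _ _ hXt hBt (by rw [hct]; omega)
  have hU4 := hUT1 _ _ hXt' hBt' (by rw [hct']; omega)
  have hrel := alt_normalForm_mem_of_gface_mem_of_unique hw hk hc2 hwc L htw hf 1 Qm Qm Qm hU1 hU2 hU3 hU4
  rw [rt_one, ← eT₁, hX, normalForm_one_eq_of_spectator hw hk hc2 hwc _ hXtt' hBtt' huT1 hu0,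
    normalForm_one_eq_of_spectator hw hk hc2 hwc _ hXt hBt huT1 hu0, normalForm_one_eq_of_spectator hw hk hc2 hwc _ hXt' hBt' huT1 hu0,
    sum_insert huB] at hrel
  -- bookkeeping over `U = F_0 ∖ B'` as in part XIX
  have hU : t ∈ (univ.filter fun s : G => w s = 0) \ B' := mem_sdiff.mpr ⟨htF, htB⟩
  have hU' : t' ∈ (univ.filter fun s : G => w s = 0) \ B' := mem_sdiff.mpr ⟨ht'F, ht'B⟩
  simp only [sdiff_insert] at hrel
  set Hf : G → (CMF G c →₀ ℤ) := fun s => (Finsupp.single (oflipCM c hc2 s (arcType hw hk hc2 hwc 1)) (1 : ℤ) - Finsupp.single (arcType hw hk hc2 hwc 1) 1) with hHf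
  set U := (univ.filter fun s : G => w s = 0) \ B' with hUdef
  have e1 : (∑ s ∈ U.erase t, Hf s) = Hf t' + ∑ s ∈ (U.erase t').erase t, Hf s := by
    rw [← add_sum_erase _ _ (mem_erase.mpr ⟨htt'.symm, hU'⟩), erase_right_comm]
  have e2 : (∑ s ∈ U.erase t', Hf s) = Hf t + ∑ s ∈ (U.erase t').erase t, Hf s := by
    rw [← add_sum_erase _ _ (mem_erase.mpr ⟨htt', hU⟩)]
  have e3 : (∑ s ∈ U, Hf s) = Hf t + (Hf t' + ∑ s ∈ (U.erase t').erase t, Hf s) := by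
    rw [← add_sum_erase _ _ hU, e1]
  rw [e1, e2] at hrel
  rw [e3]
  convert hrel using 1
  abel

/-! ## §3 The unit arc shift and its transport -/

/-- **THE UNIT ARC SHIFT at a spectator** from the plain and the spectator three-across relations. [folklore] -/
theorem unitShift_mem_of_rels (hw : ∀ P Q : G, w (P * Q) = w P + w Q) (hk : 1 ≤ k) (hc2 : c * c = 1) (hwc : w c ≠ 0)
    (L : Submodule ℤ (CMF G c →₀ ℤ)) {B' : Finset G} {u : G}
    (h3 : Finsupp.single (arcType hw hk hc2 hwc 0) (1 : ℤ) - Finsupp.single (arcType hw hk hc2 hwc 1) 1 + (∑ s ∈ B', (Finsupp.single (oflipCM c hc2 s (arcType hw hk hc2 hwc 0)) (1 : ℤ) - Finsupp.single (arcType hw hk hc2 hwc 0) 1)) - (∑ s ∈ (univ.filter fun s : G => w s = 0) \ B', (Finsupp.single (oflipCM c hc2 s (arcType hw hk hc2 hwc 1)) (1 : ℤ) - Finsupp.single (arcType hw hk hc2 hwc 1) 1)) ∈ L)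
    (h3u : Finsupp.single (arcType hw hk hc2 hwc 0) (1 : ℤ) - Finsupp.single (arcType hw hk hc2 hwc 1) 1 + (∑ s ∈ B', (Finsupp.single (oflipCM c hc2 s (arcType hw hk hc2 hwc 0)) (1 : ℤ) - Finsupp.single (arcType hw hk hc2 hwc 0) 1)) - (∑ s ∈ (univ.filter fun s : G => w s = 0) \ B', (Finsupp.single (oflipCM c hc2 s (arcType hw hk hc2 hwc 1)) (1 : ℤ) - Finsupp.single (arcType hw hk hc2 hwc 1) 1)) +
      ((Finsupp.single (oflipCM c hc2 u (arcType hw hk hc2 hwc 0)) (1 : ℤ) - Finsupp.single (arcType hw hk hc2 hwc 0) 1) - (Finsupp.single (oflipCM c hc2 u (arcType hw hk hc2 hwc 1)) (1 : ℤ) - Finsupp.single (arcType hw hk hc2 hwc 1) 1)) ∈ L) :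
    (Finsupp.single (oflipCM c hc2 u (arcType hw hk hc2 hwc 0)) (1 : ℤ) - Finsupp.single (arcType hw hk hc2 hwc 0) 1) - (Finsupp.single (oflipCM c hc2 u (arcType hw hk hc2 hwc 1)) (1 : ℤ) - Finsupp.single (arcType hw hk hc2 hwc 1) 1) ∈ L := by
  have h := Submodule.sub_mem _ h3u h3
  rwa [add_sub_cancel_left] at h

/-- **Transport of the unit shift along the kernel and the arcs**: from the unit shift at `u₀` (for the pair `T_0, T_1`) to the unit shift at any `u` with
`w u = w u₀ + a` for the pair `T_a, T_{a+1}` (central `c`). [folklore] -/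
theorem unitShift_transport (hw : ∀ P Q : G, w (P * Q) = w P + w Q) (hk : 1 ≤ k) (hc2 : c * c = 1) (hcen : ∀ x : G, x * c = c * x) (hwc : w c ≠ 0)
    (S : Finset (CMF G c →₀ ℤ)) {u₀ u : G} {a : ZMod (2 ^ k)} (ha : w u = w u₀ + a)
    (h : (Finsupp.single (oflipCM c hc2 u₀ (arcType hw hk hc2 hwc 0)) (1 : ℤ) - Finsupp.single (arcType hw hk hc2 hwc 0) 1) - (Finsupp.single (oflipCM c hc2 u₀ (arcType hw hk hc2 hwc 1)) (1 : ℤ) - Finsupp.single (arcType hw hk hc2 hwc 1) 1) ∈ Submodule.span ℤ (pairSet c) ⊔ Submodule.span ℤ (translates c S)) :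
    (Finsupp.single (oflipCM c hc2 u (arcType hw hk hc2 hwc a)) (1 : ℤ) - Finsupp.single (arcType hw hk hc2 hwc a) 1) -
      (Finsupp.single (oflipCM c hc2 u (arcType hw hk hc2 hwc (a + 1))) (1 : ℤ) - Finsupp.single (arcType hw hk hc2 hwc (a + 1)) 1) ∈
      Submodule.span ℤ (pairSet c) ⊔ Submodule.span ℤ (translates c S) := by
  have hQ : w (u⁻¹ * u₀) = -a := by rw [hw, map_inv hw, ha]; abel
  have eu : u₀ * (u⁻¹ * u₀)⁻¹ = u := by rw [mul_inv_rev, inv_inv, mul_inv_cancel_left]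
  have h' := mapDomain_rt_mem_psp c hcen (u⁻¹ * u₀) S h
  simp only [Finsupp.mapDomain_sub, Finsupp.mapDomain_single, rt_oflipCM, rt_arcType, hQ, eu, sub_neg_eq_add, zero_add] at h'
  rwa [show (1 : ZMod (2 ^ k)) + a = a + 1 from add_comm _ _] at h'

/-! ## §4 Telescoping the unit shifts to the arc-shift vectors -/

/-- **ARC SHIFTS FROM UNIT SHIFTS**: if `ℤ⟨pairs⟩ + ℤ[G]·S` contains the unit shift at every position `1, …, i` (one representative each), then it contains
`Y(u) = [T_0^{(u)}] − [T_0] − [T_i^{(u)}] + [T_i]` for every `u` with `w u = i` (`w` onto, `c` central). [folklore] -/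
theorem shift_mem_of_unitShifts (hw : ∀ P Q : G, w (P * Q) = w P + w Q) (hk : 1 ≤ k) (hc2 : c * c = 1) (hcen : ∀ x : G, x * c = c * x)
    (hwc : w c ≠ 0) (h1 : ∃ g₁ : G, w g₁ = 1) (S : Finset (CMF G c →₀ ℤ)) :
    ∀ i : ℕ, (∀ j : ℕ, 1 ≤ j → j ≤ i → ∃ u₀ : G, w u₀ = (j : ZMod (2 ^ k)) ∧
        (Finsupp.single (oflipCM c hc2 u₀ (arcType hw hk hc2 hwc 0)) (1 : ℤ) - Finsupp.single (arcType hw hk hc2 hwc 0) 1) - (Finsupp.single (oflipCM c hc2 u₀ (arcType hw hk hc2 hwc 1)) (1 : ℤ) - Finsupp.single (arcType hw hk hc2 hwc 1) 1) ∈ Submodule.span ℤ (pairSet c) ⊔ Submodule.span ℤ (translates c S)) →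
      ∀ u : G, w u = (i : ZMod (2 ^ k)) →
        Finsupp.single (oflipCM c hc2 u (arcType hw hk hc2 hwc 0)) (1 : ℤ) - Finsupp.single (arcType hw hk hc2 hwc 0) 1 -
          Finsupp.single (oflipCM c hc2 u (arcType hw hk hc2 hwc (i : ZMod (2 ^ k)))) 1 + Finsupp.single (arcType hw hk hc2 hwc (i : ZMod (2 ^ k))) 1 ∈
          Submodule.span ℤ (pairSet c) ⊔ Submodule.span ℤ (translates c S) := by
  intro i
  induction i with
  | zero =>
    intro _ u _
    rw [Nat.cast_zero]
    convert Submodule.zero_mem (Submodule.span ℤ (pairSet c) ⊔ Submodule.span ℤ (translates c S)) using 1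
    abel
  | succ i ih =>
    intro hunit u hu
    have ih' := ih (fun j hj hji => hunit j hj (by omega))
    obtain ⟨u₀, hu₀, hsh⟩ := hunit (i + 1) (by omega) le_rfl
    -- the unit shift at `u` for the pair `(T_0, T_1)`
    have hU := unitShift_transport hw hk hc2 hcen hwc S (u₀ := u₀) (u := u) (a := 0) (by rw [hu, hu₀, add_zero]) hsh
    rw [zero_add] at hU
    -- the induction hypothesis at `u·Q` (`w Q = −1`), transported along `Q` to the pair `(T_1, T_{i+1})`
    obtain ⟨Q, hQ⟩ := exists_apply_eq hw h1 (-1)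
    have huQ : w (u * Q) = (i : ZMod (2 ^ k)) := by rw [hw, hu, hQ, Nat.cast_succ]; abel
    have hI := mapDomain_rt_mem_psp c hcen Q S (ih' (u * Q) huQ)
    simp only [Finsupp.mapDomain_add, Finsupp.mapDomain_sub, Finsupp.mapDomain_single, rt_oflipCM, rt_arcType, hQ, sub_neg_eq_add, zero_add,
      mul_inv_cancel_right] at hI
    rw [Nat.cast_succ]
    have h := Submodule.add_mem _ hU hI
    convert h using 1
    abel

end

end Summit.HodgeConjecture.CorCM.Census.CyclicCharacter
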